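import Literature.Probability.LatticeModels.IsingEffectiveField
import Literature.Probability.LatticeModels.PlusFreeComparison
import HarnessLib

/-!
# GHS: the truncated pair function decreases under added fields; `⟨σₓ;σ_y⟩⁺_{Λ;β,0} ≤ ⟨σₓσ_y⟩^∅_{Λ;β,0}`

Topic `Probability/LatticeModels`, namespace `Literature.Probability.LatticeModels`.

A classical consequence of the GHS inequality `u₃ ≤ 0` (Griffiths–Hurst–Sherman 1970; Lebowitz,
Comm. Math. Phys. 35 (1974) 87, eq. (1.8) and §2, Remark (ii): "for nonnegative fields the
truncated pair function is nonincreasing in the fields") for the finite-volume Ising model with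
`+` versus free boundary condition at zero field:

  `⟨σₓσ_y⟩⁺_{Λ;β,0} - ⟨σₓ⟩⁺_{Λ;β,0} ⟨σ_y⟩⁺_{Λ;β,0} ≤ ⟨σₓσ_y⟩^∅_{Λ;β,0}`   (`β ≥ 0`, `x, y ∈ Λ`)

on an arbitrary locally finite graph (`isingTrunc_plus_le_free`, `isingCorr_pair_trunc_plus_le_free`).
This is the "celebrated application of the GHS inequality" invoked by Chelkak–Hongler–Izyurov,
*Conformal invariance of spin correlations in the planar Ising model*, Ann. of Math. 181 (2015) =
arXiv:1202.2838, in the proof of Lemma 2.26 (citing Dembo–Montanari, Ann. Appl. Probab. 20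
(2010) 565): `𝔼⁺_{Ω_δ}[σ_aσ_{a₁}] - 𝔼⁺_{Ω_δ}[σ_a]𝔼⁺_{Ω_δ}[σ_{a₁}] ≤ 𝔼^free_{Ω_δ}[σ_aσ_{a₁}]`; it is
the input through which the lower bound of that lemma reduces to CHI Thm 1.1 (free case).

Proof. The `+` state of `Λ` is the free state of `Λ` plus the nonnegative one-body couplings
`β` of the boundary bonds (Friedli–Velenik 2017, §3.8.1, p. 141: `K_{{i}} = h + β #{j ∉ Λ : j ∼ i}`);
along the affine path `K^∅ + t (K⁺ - K^∅)`, `t ∈ [0, 1]`, the truncated pair function has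
derivative `∑ᵢ Wᵢ u₃(x, y, zᵢ) ≤ 0` — both facts are already in the tree
(`hasDerivAt_gksTrunc_affCpl`, `deriv_gksTrunc_affCpl_nonpos` of `IsingEffectiveField`, on top of
`gksExpect_ghs`); this file integrates them (`antitoneOn_gksTrunc_affCpl`, `gksTrunc_affCpl_one_le`;
cf. the sibling `antitoneOn_gksTrunc_cplAt` of `MeanFieldBoundGHS` for the scaling path `cplAt`,
used there and in `TwoPointPlusDecay` to bound `⟨σ⟩⁺ - ⟨σ⟩^∅` and `⟨σσ⟩⁺ - ⟨σσ⟩^∅` by boundary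
terms) and identifies the endpoints, using `⟨σₓ⟩^∅_{Λ;β,0} = 0` (`isingCorr_free_zero_of_odd`).
What is NOT here: any infinite-volume statement; fields `h > 0` (then `⟨σₓ⟩^∅ ≠ 0` and only the
truncated comparison `gksTrunc_affCpl_one_le` is meaningful).

## References

* J. L. Lebowitz, *GHS and other inequalities*, Comm. Math. Phys. 35 (1974) 87–92, eq. (1.8),
  §2 Remark (ii) [Lebowitz1974].
* S. Friedli, Y. Velenik, *Statistical Mechanics of Lattice Systems* (CUP 2017), §3.8.1 p. 141,
  §3.9 p. 140 [FriedliVelenik2017].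
* D. Chelkak, C. Hongler, K. Izyurov, Ann. of Math. 181 (2015) 1087–1138, arXiv:1202.2838, §2.10,
  proof of Lemma 2.26 [ChelkakHonglerIzyurovAnnals2015].
-/

noncomputable section

open Finset
open scoped symmDiff

namespace Literature.Probability.LatticeModels

/-! ### Integrating the GHS sign along an affine one-body deformation -/

section GKS

variable {Λ : Type*} [Fintype Λ] [DecidableEq Λ] {ι : Type*}
variable (s : Finset ι) (K W : ι → ℝ) (C : ι → Finset Λ)

/-- **The truncated pair function is non-increasing along a nonnegative one-body deformation**
(GHS, integrated): for supports of at most two sites, a direction `W ≥ 0` charging only one-site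
terms, and `t₀` with `K + t₀W ≥ 0`, the function
`t ↦ ⟨σₓσ_y⟩_{K+tW} - ⟨σₓ⟩_{K+tW}⟨σ_y⟩_{K+tW}` is antitone on `[t₀, ∞)` (its derivative is
`∑ᵢ Wᵢ u₃(x,y,zᵢ) ≤ 0`, `deriv_gksTrunc_affCpl_nonpos`; Lebowitz 1974, §2, Remark (ii)).
[cite: Lebowitz1974, eq. (1.8) and §2, Remark (ii)] -/
theorem antitoneOn_gksTrunc_affCpl (hC : ∀ i ∈ s, (C i).card ≤ 2) (hW : ∀ i ∈ s, 0 ≤ W i)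
    (hW1 : ∀ i ∈ s, W i ≠ 0 → ∃ z, C i = {z}) {t₀ : ℝ} (hK0 : ∀ i ∈ s, 0 ≤ affCpl K W t₀ i)
    (x y : Λ) :
    AntitoneOn (fun t => gksExpect s (affCpl K W t) C (fun σ => spinAt x σ * spinAt y σ) -
        gksExpect s (affCpl K W t) C (spinAt x) * gksExpect s (affCpl K W t) C (spinAt y))
      (Set.Ici t₀) := by
  have hKt : ∀ t, t₀ ≤ t → ∀ i ∈ s, 0 ≤ affCpl K W t i := by
    intro t ht i hi
    have h0 := hK0 i hi
    simp only [affCpl] at h0 ⊢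
    nlinarith [hW i hi]
  have hderiv := fun t => hasDerivAt_gksTrunc_affCpl s K W C x y t
  refine antitoneOn_of_deriv_nonpos (convex_Ici t₀)
    (fun t _ => (hderiv t).continuousAt.continuousWithinAt)
    (fun t _ => (hderiv t).differentiableAt.differentiableWithinAt) fun t ht => ?_
  rw [interior_Ici] at ht
  rw [(hderiv t).deriv]
  exact deriv_gksTrunc_affCpl_nonpos s K W C hC hW hW1 (hKt t (le_of_lt ht)) x y

/-- **Adding nonnegative one-body couplings lowers the truncated pair function**: for `K ≥ 0` on
supports of at most two sites and a direction `W ≥ 0` charging only one-site terms,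
`⟨σₓσ_y⟩_{K+W} - ⟨σₓ⟩_{K+W}⟨σ_y⟩_{K+W} ≤ ⟨σₓσ_y⟩_K - ⟨σₓ⟩_K⟨σ_y⟩_K` (GHS integrated from `t = 0`
to `t = 1`). [cite: Lebowitz1974, eq. (1.8) and §2, Remark (ii)] -/
theorem gksTrunc_affCpl_one_le (hK : ∀ i ∈ s, 0 ≤ K i) (hC : ∀ i ∈ s, (C i).card ≤ 2)
    (hW : ∀ i ∈ s, 0 ≤ W i) (hW1 : ∀ i ∈ s, W i ≠ 0 → ∃ z, C i = {z}) (x y : Λ) :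
    gksExpect s (affCpl K W 1) C (fun σ => spinAt x σ * spinAt y σ) -
        gksExpect s (affCpl K W 1) C (spinAt x) * gksExpect s (affCpl K W 1) C (spinAt y) ≤
      gksExpect s K C (fun σ => spinAt x σ * spinAt y σ) -
        gksExpect s K C (spinAt x) * gksExpect s K C (spinAt y) := by
  have hK0 : ∀ i ∈ s, 0 ≤ affCpl K W 0 i := fun i hi => by simpa [affCpl] using hK i hi
  have h := antitoneOn_gksTrunc_affCpl s K W C hC hW hW1 hK0 x y (Set.mem_Ici.2 le_rfl)
    (Set.mem_Ici.2 zero_le_one) zero_le_one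
  simpa only [affCpl_zero] using h

end GKS

/-! ### The Ising application: `⟨σₓσ_y⟩⁺ - ⟨σₓ⟩⁺⟨σ_y⟩⁺ ≤ ⟨σₓσ_y⟩^∅` at zero field -/

section Ising

variable {V : Type*} [DecidableEq V] (G : SimpleGraph V) [G.LocallyFinite]

/-- The `+` couplings dominate the free couplings termwise: they agree on the edges inside `Λ` and
on the site terms, and differ by `β ≥ 0` on the boundary edges (Friedli–Velenik 2017, §3.8.1,
p. 141). [cite: FriedliVelenik2017, §3.8.1, p. 141] -/
theorem gksCoupling_free_le_plus {Λ : Finset V} {β : ℝ} (hβ : 0 ≤ β) (h : ℝ) :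
    ∀ i ∈ isingIdx G Λ, gksCoupling G Λ β h .free i ≤ gksCoupling G Λ β h .plus i := by
  rintro (e | x) hi
  · rw [isingIdx, Finset.inl_mem_disjSum] at hi
    rw [gksCoupling_plus_inl G β h hi]
    simp only [gksCoupling, interactionEdges_free]
    split_ifs with he
    · rw [edgeCoeff_of_mem_edgesIn G _ he, mul_one]
    · exact hβ
  · simp only [gksCoupling]
    exact le_rfl

/-- A boundary edge `{a, b}`, `a ∈ Λ`, `b ∉ Λ`, acts on `Λ` through the single site `a`:
`isingSupp Λ (inl {a,b}) = {a}`. [cite: FriedliVelenik2017, §3.8.1, p. 141] -/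
theorem isingSupp_inl_eq_singleton {Λ : Finset V} {a b : V} (ha : a ∈ Λ) (hb : b ∉ Λ) :
    isingSupp Λ (.inl s(a, b)) = {⟨a, ha⟩} := by
  ext z
  simp only [isingSupp, Finset.mem_filter, Finset.mem_univ, true_and, Finset.mem_singleton,
    Sym2.mem_iff]
  constructor
  · rintro (h | h)
    · exact Subtype.ext h
    · exact absurd (h ▸ z.2) hb
  · intro h
    exact Or.inl (by rw [h])

/-- Where the `+` and free couplings differ, the support is a single site (a boundary edge seen
from inside `Λ`). [cite: FriedliVelenik2017, §3.8.1, p. 141] -/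
theorem exists_isingSupp_eq_singleton_of_ne {Λ : Finset V} {β h : ℝ} :
    ∀ i ∈ isingIdx G Λ, gksCoupling G Λ β h .plus i - gksCoupling G Λ β h .free i ≠ 0 →
      ∃ z : ↥Λ, isingSupp Λ i = {z} := by
  rintro (e | x) hi hne
  · rw [isingIdx, Finset.inl_mem_disjSum] at hi
    have hnot : e ∉ edgesIn G Λ := by
      intro he
      apply hne
      rw [gksCoupling_plus_inl G β h hi]
      simp only [gksCoupling, interactionEdges_free, he, if_true]
      rw [edgeCoeff_of_mem_edgesIn G _ he, mul_one, sub_self]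
    rw [mem_edgesTouching_iff] at hi
    obtain ⟨heG, z, hzΛ, hze⟩ := hi
    induction e using Sym2.ind with
    | _ a b =>
      have hnot' : ¬ (a ∈ Λ ∧ b ∈ Λ) := by
        intro h'
        apply hnot
        rw [mem_edgesIn_iff]
        refine ⟨heG, fun v hv => ?_⟩
        rcases Sym2.mem_iff.1 hv with rfl | rfl
        · exact h'.1
        · exact h'.2
      rcases Sym2.mem_iff.1 hze with rfl | rfl
      · exact ⟨⟨z, hzΛ⟩, isingSupp_inl_eq_singleton hzΛ fun hb => hnot' ⟨hzΛ, hb⟩⟩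
      · have ha : a ∉ Λ := fun ha => hnot' ⟨ha, hzΛ⟩
        refine ⟨⟨z, hzΛ⟩, ?_⟩
        rw [Sym2.eq_swap]
        exact isingSupp_inl_eq_singleton hzΛ ha
  · exfalso
    apply hne
    simp only [gksCoupling, sub_self]

/-- **`⟨σₓσ_y⟩⁺_{Λ;β,0} - ⟨σₓ⟩⁺_{Λ;β,0}⟨σ_y⟩⁺_{Λ;β,0} ≤ ⟨σₓσ_y⟩^∅_{Λ;β,0}`** for the finite-volume
Ising model on any locally finite graph, `β ≥ 0`, `x, y ∈ Λ`: the `+` boundary condition is the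
free one plus the nonnegative boundary fields `β #{j ∉ Λ : j ∼ i}`, the truncated pair function
decreases in the fields by GHS (`gksTrunc_affCpl_one_le`), and `⟨σₓ⟩^∅_{Λ;β,0} = 0`. This is the
application of GHS in Chelkak–Hongler–Izyurov's proof of Lemma 2.26 (arXiv:1202.2838, citing
Dembo–Montanari 2010): `𝔼⁺_{Ω_δ}[σ_aσ_{a₁}] - 𝔼⁺_{Ω_δ}[σ_a]𝔼⁺_{Ω_δ}[σ_{a₁}] ≤ 𝔼^free_{Ω_δ}[σ_aσ_{a₁}]`.
[cite: ChelkakHonglerIzyurovAnnals2015, §2.10, proof of Lemma 2.26 (GHS application)] -/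
theorem isingTrunc_plus_le_free {Λ : Finset V} {β : ℝ} (hβ : 0 ≤ β) {x y : V} (hx : x ∈ Λ)
    (hy : y ∈ Λ) :
    isingExpect G Λ β 0 .plus (fun σ => spinAt x σ * spinAt y σ) -
        isingExpect G Λ β 0 .plus (spinAt x) * isingExpect G Λ β 0 .plus (spinAt y) ≤
      isingExpect G Λ β 0 .free (fun σ => spinAt x σ * spinAt y σ) := by
  set K : Sym2 V ⊕ V → ℝ := gksCoupling G Λ β 0 .free with hKdef
  set W : Sym2 V ⊕ V → ℝ := fun i => gksCoupling G Λ β 0 .plus i - gksCoupling G Λ β 0 .free i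
    with hWdef
  have hKW : affCpl K W 1 = gksCoupling G Λ β 0 .plus := by
    funext i
    simp only [affCpl, hKdef, hWdef]
    ring
  have hK : ∀ i ∈ isingIdx G Λ, 0 ≤ K i := gksCoupling_nonneg G hβ le_rfl (Or.inl rfl)
  have hW : ∀ i ∈ isingIdx G Λ, 0 ≤ W i := fun i hi =>
    sub_nonneg.2 (gksCoupling_free_le_plus G hβ 0 i hi)
  have hW1 : ∀ i ∈ isingIdx G Λ, W i ≠ 0 → ∃ z : ↥Λ, isingSupp Λ i = {z} :=
    exists_isingSupp_eq_singleton_of_ne G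
  have hgks := gksTrunc_affCpl_one_le (isingIdx G Λ) K W (isingSupp Λ) hK
    (fun i _ => card_isingSupp_le_two Λ i) hW hW1 ⟨x, hx⟩ ⟨y, hy⟩
  rw [hKW] at hgks
  -- translate to `isingExpect`
  have mx := measurable_spinAt (V := V) x
  have my := measurable_spinAt (V := V) y
  have mxy : Measurable fun σ : SpinConfig V => spinAt x σ * spinAt y σ := mx.mul my
  have hfree0 : isingExpect G Λ β 0 .free (spinAt x) = 0 := by
    have h := isingCorr_free_zero_of_odd G Λ β (Finset.singleton_subset_iff.2 hx)
      (by simp : Odd #({x} : Finset V))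
    have hsp : spinProduct ({x} : Finset V) = spinAt x := by
      funext σ; simp [spinProduct]
    rwa [isingCorr, hsp] at h
  have key : isingExpect G Λ β 0 .plus (fun σ => spinAt x σ * spinAt y σ) -
        isingExpect G Λ β 0 .plus (spinAt x) * isingExpect G Λ β 0 .plus (spinAt y) ≤
      isingExpect G Λ β 0 .free (fun σ => spinAt x σ * spinAt y σ) -
        isingExpect G Λ β 0 .free (spinAt x) * isingExpect G Λ β 0 .free (spinAt y) := by
    rw [isingExpect_eq_gksSum_div G Λ β 0 .plus mxy, isingExpect_eq_gksSum_div G Λ β 0 .plus mx,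
      isingExpect_eq_gksSum_div G Λ β 0 .plus my, isingExpect_eq_gksSum_div G Λ β 0 .free mxy,
      isingExpect_eq_gksSum_div G Λ β 0 .free mx, isingExpect_eq_gksSum_div G Λ β 0 .free my]
    simp only [spinAt_glue_of_mem _ _ hx, spinAt_glue_of_mem _ _ hy]
    simpa only [gksExpect, hKdef] using hgks
  rw [hfree0, zero_mul, sub_zero] at key
  exact key

/-- Set-indexed form: for distinct `x, y ∈ Λ` and `β ≥ 0`,
`⟨σ_{{x,y}}⟩⁺_{Λ;β,0} - ⟨σ_{{x}}⟩⁺_{Λ;β,0} ⟨σ_{{y}}⟩⁺_{Λ;β,0} ≤ ⟨σ_{{x,y}}⟩^∅_{Λ;β,0}`.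
[cite: ChelkakHonglerIzyurovAnnals2015, §2.10, proof of Lemma 2.26 (GHS application)] -/
theorem isingCorr_pair_trunc_plus_le_free {Λ : Finset V} {β : ℝ} (hβ : 0 ≤ β) {x y : V}
    (hx : x ∈ Λ) (hy : y ∈ Λ) (hxy : x ≠ y) :
    isingCorr G Λ β 0 .plus {x, y} - isingCorr G Λ β 0 .plus {x} * isingCorr G Λ β 0 .plus {y} ≤
      isingCorr G Λ β 0 .free {x, y} := by
  have h := isingTrunc_plus_le_free G hβ hx hy
  have hsp2 : spinProduct ({x, y} : Finset V) = fun σ => spinAt x σ * spinAt y σ := by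
    funext σ; simp [spinProduct, Finset.prod_pair hxy]
  have hspx : spinProduct ({x} : Finset V) = spinAt x := by funext σ; simp [spinProduct]
  have hspy : spinProduct ({y} : Finset V) = spinAt y := by funext σ; simp [spinProduct]
  simp only [isingCorr, hsp2, hspx, hspy]
  exact h

end Ising

end Literature.Probability.LatticeModels
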